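import Literature.NumberTheory.Transcendental.TwoCurveThetaLaws
import Literature.NumberTheory.Transcendental.PkappaThetaMultiplication
import HarnessLib

/-!
# Multiplication by `n` on the two-lattice theta model: complete families of forms

Topic `Literature/NumberTheory/Transcendental`; unit
`provefact-Literature.NumberTheory.Transcendental.H-a66b67e3eb` (fact
`Literature.NumberTheory.Transcendental.HuberWustholzTwoCurvePeriods`). It introduces NO named fact.
Two-lattice counterpart of `PkappaThetaMultiplication.lean` for the theta model of the two-lattice
standard models `M = 𝔾ₘ^β × P` (laws of `TwoCurveThetaLaws.lean`, blockwise lattices): iterating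
the complete system of composite addition laws (`GaGmEE.Std.claw`, `eval_claw`,
`exists_clawUnit_clawFamily_ne_zero`) gives forms computing the multiplication maps `[n+1]` of the
group in the theta embedding —

* `mulForm l I` (degree `mulDeg |l|`, `mulForm_isHomogeneous`) with
  **`F_{mulForm l I}(w) = mulUnit l w · Θ_I((|l|+1) w)`** for ALL `w` (`thetaEval_mulForm`), the
  unit `mulUnit l` an explicit entire function (`analyticOnNhd_mulUnit`);
* completeness `exists_mulUnit_ne_zero`, and the summary `exists_complete_multiplication_forms`.

These are the forms the classification of the obstruction subgroups with two or more elliptic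
factors uses to cut out algebraic subgroups. Generic material reused: `mulDeg`,
`isHomogeneous_bind₁_sumElim`, `GaGmE.Std.nClaw`.

## References

* Yu. V. Nesterenko, P. Philippon (eds.), *Introduction to Algebraic Independence Theory*,
  LNM 1752, Springer 2001, Ch. 11 (D. Roy), §2.1. [NesterenkoPhilippon2001]
* D. Bertrand, P. Philippon, *Sous-groupes algébriques de groupes algébriques commutatifs*,
  Illinois J. Math. 32 (1988), 263–280. [folklore]
* A. Huber, G. Wüstholz, *Transcendence and Linear Relations of 1-Periods*, CUP 2022, Thm. 15.3.
  [HuberWustholz2022]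
-/

noncomputable section

open Complex MvPolynomial Set
open scoped PeriodPair

namespace Literature.NumberTheory.Transcendental

namespace GaGmEE

namespace Std

open GaGmE (Kbar)
open GaGmE.Std (iy iz is coords ThetaIdx thetaT thetaT_none thetaT_some nClaw clawPt mulDeg)

variable {β γ γ' δ : Type} [Fintype β] [Fintype γ] [Fintype γ'] [Fintype δ] [DecidableEq γ] [DecidableEq γ']
variable (L L' : PeriodPair) (κM : δ → γ ⊕ γ' → Kbar)



/-! ### The multiplication forms -/

/-- **The multiplication forms**: `mulForm [] I = X_I`,
`mulForm (s :: l) I = A^{(s)}_I(mulForm l, X)`. [folklore] -/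
def mulForm : List (β ⊕ ((γ ⊕ γ') ⊕ δ) → ℂ) → Option β × ThetaIdx (γ ⊕ γ') δ →
    MvPolynomial (Option β × ThetaIdx (γ ⊕ γ') δ) ℂ
  | [], I => X I
  | s :: l, I => bind₁ (Sum.elim (mulForm l) X) (claw L L' κM s I)

/-- **The units of the multiplication forms**: `mulUnit [] = 1`,
`mulUnit (s :: l) w = (mulUnit l w)⁴ · U_s((|l|+1) w, w)`. [folklore] -/
def mulUnit : List (β ⊕ ((γ ⊕ γ') ⊕ δ) → ℂ) → (β ⊕ ((γ ⊕ γ') ⊕ δ) → ℂ) → ℂ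
  | [], _ => 1
  | s :: l, w => mulUnit l w ^ 4 * clawUnit (β := β) (δ := δ) L L' s ((l.length + 1) • w) w

omit [Fintype β] [Fintype δ] in
/-- Unfolding, empty chain. [folklore] -/
@[simp] theorem mulForm_nil (I : Option β × ThetaIdx (γ ⊕ γ') δ) : mulForm L L' κM [] I = X I := rfl

omit [Fintype β] [Fintype δ] in
/-- Unfolding, one more step. [folklore] -/
@[simp] theorem mulForm_cons (s : β ⊕ ((γ ⊕ γ') ⊕ δ) → ℂ) (l : List (β ⊕ ((γ ⊕ γ') ⊕ δ) → ℂ)) (I : Option β × ThetaIdx (γ ⊕ γ') δ) :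
    mulForm L L' κM (s :: l) I = bind₁ (Sum.elim (mulForm L L' κM l) X) (claw L L' κM s I) := rfl

omit [Fintype β] [Fintype δ] [DecidableEq γ] [DecidableEq γ'] in
/-- Unfolding, empty chain. [folklore] -/
@[simp] theorem mulUnit_nil (w : β ⊕ ((γ ⊕ γ') ⊕ δ) → ℂ) : mulUnit (β := β) (δ := δ) L L' [] w = 1 := rfl

omit [Fintype β] [Fintype δ] [DecidableEq γ] [DecidableEq γ'] in
/-- Unfolding, one more step. [folklore] -/
@[simp] theorem mulUnit_cons (s : β ⊕ ((γ ⊕ γ') ⊕ δ) → ℂ) (l : List (β ⊕ ((γ ⊕ γ') ⊕ δ) → ℂ)) (w : β ⊕ ((γ ⊕ γ') ⊕ δ) → ℂ) :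
    mulUnit (β := β) (δ := δ) L L' (s :: l) w =
      mulUnit (β := β) (δ := δ) L L' l w ^ 4 * clawUnit (β := β) (δ := δ) L L' s ((l.length + 1) • w) w := rfl

omit [Fintype β] [Fintype δ] in
/-- **The multiplication forms are forms of degree `mulDeg |l|`.** [folklore] -/
theorem mulForm_isHomogeneous (l : List (β ⊕ ((γ ⊕ γ') ⊕ δ) → ℂ)) (I : Option β × ThetaIdx (γ ⊕ γ') δ) :
    (mulForm L L' κM l I).IsHomogeneous (mulDeg l.length) := by
  induction l generalizing I with
  | nil => simpa [mulDeg] using isHomogeneous_X ℂ I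
  | cons s l ih =>
    rw [mulForm_cons, List.length_cons, mulDeg]
    exact isHomogeneous_bind₁_sumElim (claw_isWeightedHomogeneous L L' κM s I)
      (claw_isWeightedHomogeneous_wY L L' κM s I) ih

omit [Fintype β] [Fintype δ] in
/-- **`F_{mulForm l I}(w) = mulUnit l w · Θ_I((|l| + 1) w)`** for ALL `w`: the forms compute the
multiplication by `|l| + 1` up to the unit. [folklore] -/
theorem thetaEval_mulForm (l : List (β ⊕ ((γ ⊕ γ') ⊕ δ) → ℂ)) (I : Option β × ThetaIdx (γ ⊕ γ') δ) (w : β ⊕ ((γ ⊕ γ') ⊕ δ) → ℂ) :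
    thetaEval L L' κM (mulForm L L' κM l I) w = mulUnit (β := β) (δ := δ) L L' l w * theta L L' κM I ((l.length + 1) • w) := by
  induction l generalizing I with
  | nil => simp [thetaEval]
  | cons s l ih =>
    rw [mulForm_cons, thetaEval, eval_bind₁, mulUnit_cons, List.length_cons]
    have hfun : (fun i => eval (fun J => theta L L' κM J w) (Sum.elim (mulForm L L' κM l) X i)) =
        fun i => mulUnit (β := β) (δ := δ) L L' l w ^ wX (Option β × ThetaIdx (γ ⊕ γ') δ) i *
          Sum.elim (fun J => theta L L' κM J ((l.length + 1) • w)) (fun J => theta L L' κM J w) i := by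
      funext i
      rcases i with J | J
      · simp only [Sum.elim_inl, wX, pow_one]
        exact ih J
      · simp only [Sum.elim_inr, wX, pow_zero, one_mul, eval_X]
    rw [hfun, eval_pow_weight_mul_of_isWeightedHomogeneous (claw_isWeightedHomogeneous L L' κM s I), eval_claw,
      succ_nsmul]
    ring

omit [Fintype β] [Fintype δ] [DecidableEq γ] [DecidableEq γ'] in
/-- **Completeness**: for every `n` and every `w` some chain of length `n` from the finite family
`clawFamily` has non-zero unit at `w`. [folklore] -/
theorem exists_mulUnit_ne_zero (n : ℕ) (w : β ⊕ ((γ ⊕ γ') ⊕ δ) → ℂ) :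
    ∃ c : Fin n → Fin (nClaw (γ ⊕ γ')),
      mulUnit (β := β) (δ := δ) L L' (List.ofFn fun i => clawFamily (β := β) (δ := δ) L L' (c i)) w ≠ 0 := by
  induction n with
  | zero => exact ⟨Fin.elim0, by simp⟩
  | succ n ih =>
    obtain ⟨c, hc⟩ := ih
    obtain ⟨i, hi⟩ := exists_clawUnit_clawFamily_ne_zero (β := β) (δ := δ) L L' ((n + 1) • w) w
    refine ⟨Fin.cons i c, ?_⟩
    rw [List.ofFn_succ, mulUnit_cons]
    simp only [Fin.cons_zero, Fin.cons_succ, List.length_ofFn]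
    exact mul_ne_zero (pow_ne_zero _ hc) hi

omit [DecidableEq γ] [DecidableEq γ'] in
/-- The units are entire. [folklore] -/
theorem analyticOnNhd_mulUnit (l : List (β ⊕ ((γ ⊕ γ') ⊕ δ) → ℂ)) :
    AnalyticOnNhd ℂ (mulUnit (β := β) (δ := δ) L L' l) univ := by
  induction l with
  | nil => simpa [mulUnit] using (analyticOnNhd_const (v := (1 : ℂ)))
  | cons s l ih =>
    intro w _
    have h1 : AnalyticAt ℂ (mulUnit (β := β) (δ := δ) L L' l) w := ih w (mem_univ _)
    have hlin : AnalyticAt ℂ (fun v : β ⊕ ((γ ⊕ γ') ⊕ δ) → ℂ => (((l.length + 1) • v, v) :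
        (β ⊕ ((γ ⊕ γ') ⊕ δ) → ℂ) × (β ⊕ ((γ ⊕ γ') ⊕ δ) → ℂ))) w := by
      have hs : AnalyticAt ℂ (fun v : β ⊕ ((γ ⊕ γ') ⊕ δ) → ℂ => (l.length + 1) • v) w := by
        have heq : (fun v : β ⊕ ((γ ⊕ γ') ⊕ δ) → ℂ => (l.length + 1) • v) =
            fun v => ((l.length + 1 : ℕ) : ℂ) • v := by
          funext v
          exact (Nat.cast_smul_eq_nsmul ℂ (l.length + 1) v).symm
        rw [heq]
        exact (analyticAt_const : AnalyticAt ℂ (fun _ : β ⊕ ((γ ⊕ γ') ⊕ δ) → ℂ => ((l.length + 1 : ℕ) : ℂ)) w).smul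
          (analyticAt_id : AnalyticAt ℂ (fun v : β ⊕ ((γ ⊕ γ') ⊕ δ) → ℂ => v) w)
      exact hs.prod analyticAt_id
    have h2 : AnalyticAt ℂ (Function.uncurry (clawUnit (β := β) (δ := δ) L L' s) ∘
        fun v : β ⊕ ((γ ⊕ γ') ⊕ δ) → ℂ => (((l.length + 1) • v, v) : (β ⊕ ((γ ⊕ γ') ⊕ δ) → ℂ) × (β ⊕ ((γ ⊕ γ') ⊕ δ) → ℂ))) w :=
      (analyticOnNhd_clawUnit L L' s _ (mem_univ _)).comp hlin
    have h3 := (h1.pow 4).mul h2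
    exact h3.congr (Filter.Eventually.of_forall fun v => rfl)

/-- **The complete family of multiplication forms** in one statement: for every `n ≥ 1` there are
finitely many families of forms `Φ^c_I` of one degree `d` and entire units `u_c` without common
zero with `F_{Φ^c_I}(w) = u_c(w) Θ_I(n w)` for all `w`. [folklore] -/
theorem exists_complete_multiplication_forms (n : ℕ) (hn : 1 ≤ n) :
    ∃ (m d : ℕ) (Φ : Fin m → Option β × ThetaIdx (γ ⊕ γ') δ → MvPolynomial (Option β × ThetaIdx (γ ⊕ γ') δ) ℂ)
      (u : Fin m → (β ⊕ ((γ ⊕ γ') ⊕ δ) → ℂ) → ℂ),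
      (∀ k I, (Φ k I).IsHomogeneous d) ∧ (∀ k, AnalyticOnNhd ℂ (u k) univ) ∧
      (∀ k I w, thetaEval L L' κM (Φ k I) w = u k w * theta L L' κM I (n • w)) ∧
      ∀ w, ∃ k, u k w ≠ 0 := by
  classical
  obtain ⟨n, rfl⟩ : ∃ n', n = n' + 1 := ⟨n - 1, by omega⟩
  let e := Fintype.equivFin (Fin n → Fin (nClaw (γ ⊕ γ')))
  let chain : Fin (Fintype.card (Fin n → Fin (nClaw (γ ⊕ γ')))) → List (β ⊕ ((γ ⊕ γ') ⊕ δ) → ℂ) :=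
    fun k => List.ofFn fun i => clawFamily (β := β) (δ := δ) L L' (e.symm k i)
  have hlen : ∀ k, (chain k).length = n := fun k => by simp [chain]
  refine ⟨_, mulDeg n, fun k => mulForm L L' κM (chain k), fun k => mulUnit (β := β) (δ := δ) L L' (chain k),
    fun k I => ?_, fun k => analyticOnNhd_mulUnit L L' (chain k), fun k I w => ?_, fun w => ?_⟩
  · simpa [hlen] using mulForm_isHomogeneous L L' κM (chain k) I
  · rw [thetaEval_mulForm, hlen]
  · obtain ⟨c, hc⟩ := exists_mulUnit_ne_zero (β := β) (δ := δ) L L' n w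
    exact ⟨e c, by simpa [chain] using hc⟩


end Std

end GaGmEE

end Literature.NumberTheory.Transcendental

end
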